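import Summits.QuantumFields.BalabanUV.T4Continuum.Support.VariationalVectorRegularityRho
import Summits.QuantumFields.BalabanUV.T4Continuum.Support.VariationalVectorTaxiUpperBound

/-!
# T⁴ programme, spine node NE2 (U1a), lane P2 — leaf V-REG (1-forms), file 5: V-REG CLOSED AT BAŁABAN's TAXI DATA for the Feynman–Landau form —
# on the product-line carriers `QvL (lineT (taxiTv R) R)` with UNITARY bonds `R` of plaquette defect `≤ a`, the regularity functional of V-ONE-1F satisfies
# `rhoV n M R W ≤ (4Λ_taxi + ½)·(ScV n M R (landauG 1 R) W + nsqV M φ)` at every constrained minimiser, with NO leaf binder displayed: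
# V-UB is leaf-04-g4's `exists_ubV_taxi_ScV` (p221223), (Går) ∕ V-P are leaf-09-g6's ∕ leaf-01-g5's (file 3/4 §4), V-REG is file 3/4 — the only hypotheses are
# unitarity, the plaquette defect, `1 ≤ d`, at least two blocks per direction, and three k-UNIFORM smallness conditions on `n²·a`
# (cell `pub-balaban`, NE2 formalisation swarm, leaf prover 03 gen 5)

HONEST FRAMING (T4-DAG p. 1).  Rung (B)+1 only — NOT infinite volume, NOT a mass gap, NOT Clay.  NE2 is NOT IN PRINT and NOT proved here.  MODEL LEVEL,
`E = ℂ`: the bond operators `R` are DATA; the taxi frames `taxiTv R`, the straight coarsening and the product line transports are OURS (leaf-04-g4's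
`VariationalColourTaxiTransport`, [Balaban1985AveragingOperations] (125) ∕ [Balaban1985BackgroundPropagators] (3.13), (3.19) SHAPES, c5); the Landau
functional is the tree's only typed inhabitant of the gauge term and is NOT offered as Bałaban's `G` ([B9] (3.26)).  What is proved is COMPOSITION
([folklore]) plus one piece of block bookkeeping (the base-point form of an in-block bound gives the block form when every direction has at least two blocks);
nothing printed is a hypothesis; no `def`, no `sorry`; axioms standard.  HONEST DEPENDENCY (cell, verbatim): continuum YM on T⁴ ⇐ BetaPertH ∧ nine spine
estimates (0/9 proved); BetaPertH ⇐ (D1) ∧ (D4) ∧ CAP+tail; G-an2-4 gates asym, D1 and NE2/3/4.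

CONTENTS.
 * §1 `digits_succ_lt_of_blockOf_eq` (with `1 < M μ` for every `μ`, a bond `(x, x + e_μ)` with both ends in one block is an
   INTERIOR bond: `j_μ + 1 < n` — on a torus with a single block in direction `μ` the wrap-around bond would also qualify, and its «defect» is a
   Polyakov-loop holonomy, not small), `le_of_bpt_of_blockOf_eq` (base-point form ⟹ block form of a bond bound);
 * §2 **`hREG_rhoV_landau_taxi`** — THE END of this file (statement in the title), `Λ_taxi := lamV d (n·(d−1)(n−1)a) (d/1) (n²·0) ∕ (1 − κ⁻¹·3(d−1)n(n−1)a)²`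
   (leaf-04-g4's V-UB constant at `C_G = d`, `C₀ = 0`, i.e. (GF1′) for `landauG 1` by leaf-09-g6's `landauG_le`); smallness: `2d(n·(d−1)(n−1)a)² ≤ ½`
   (in-block class), `40d(n²a) ≤ 1` (plaquette class), `κ⁻¹·3(d−1)n(n−1)a < 1` (V-UB's field-strength condition) — all k-UNIFORM under `n²·a ≤ c`.
-/

noncomputable section

open scoped BigOperators ComplexConjugate ComplexOrder Matrix

namespace Summit.QuantumFields.BalabanUV.T4Continuum.VariationalVectorRegularityTaxi

open Finset
open Literature.MathematicalPhysics.QuantumFieldTheory.Balaban1983to89.B5Prop11Plancherel (Tor fine unitVec)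
open Literature.MathematicalPhysics.QuantumFieldTheory.Balaban1983to89.B5Block118 (bpt)
open Literature.MathematicalPhysics.QuantumFieldTheory.Balaban1983to89.B5Blocks16 (blockOf blockOf_bpt bpt_bijective)
open Summit.QuantumFields.BalabanUV.T4Continuum.ScalarBlockTrialFunction (bpt_add_unitVec_of_eq)
open Summit.QuantumFields.BalabanUV.T4Continuum.VariationalColourFederbush (norm_le_one_of_mem_unitary)
open Summit.QuantumFields.BalabanUV.T4Continuum.VariationalVectorFederbush (lineT)
open Summit.QuantumFields.BalabanUV.T4Continuum.VectorBlockTrialForm (nsqV nsqV_nonneg QvL roughV kappaV)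
open Summit.QuantumFields.BalabanUV.T4Continuum.VariationalVectorForm (ScV qWV lamV lamV_nonneg)
open Summit.QuantumFields.BalabanUV.T4Continuum.VariationalVectorGarding (landauG landauG_le)
open Summit.QuantumFields.BalabanUV.T4Continuum.VariationalVectorOneStepPhys (rhoV)
open Summit.QuantumFields.BalabanUV.T4Continuum.VariationalColourTaxiTransport (taxiTv taxiTv_mem_unitary inBlock_defect_taxiTv_adjoint_le exists_ubV_taxi_ScV)
open Summit.QuantumFields.BalabanUV.T4Continuum.VariationalVectorRegularityRho (hREG_rhoV_landau_line)

variable {d : ℕ} (n : ℕ) [NeZero n] (M : Fin d → ℕ) [hM : ∀ μ, NeZero (M μ)]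

/-! ## §1 Block bookkeeping: the base-point form of an in-block bound gives the block form (two blocks per direction) -/

/-- with at least two blocks in every direction, a bond `(n·y + j, n·y + j + e_μ)` with both ends in ONE block is an interior bond: `j_μ + 1 < n`. [folklore] -/
theorem digits_succ_lt_of_blockOf_eq (hM1 : ∀ μ, 1 < M μ) {y : Tor M} {j : Fin d → Fin n} {μ : Fin d}
    (h : blockOf n M (bpt n M y j + unitVec (fine n M) μ) = blockOf n M (bpt n M y j)) : (j μ : ℕ) + 1 < n := by
  have hlt : (j μ : ℕ) + 1 ≤ n := (j μ).is_lt
  rcases lt_or_eq_of_le hlt with hlt' | heq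
  · exact hlt'
  · exfalso
    -- across a face the block changes by `e_μ`, which is nonzero on a torus with `1 < M μ`
    rw [bpt_add_unitVec_of_eq n M _ _ μ heq, blockOf_bpt, blockOf_bpt, add_eq_left] at h
    have h1 : (unitVec M μ) μ = 0 := by rw [h]; rfl
    rw [unitVec, Pi.single_eq_same] at h1
    exact (ZMod.one_eq_zero_iff.not.mpr (hM1 μ).ne') h1

omit [NeZero n] in
/-- BASE-POINT FORM ⟹ BLOCK FORM: a bound stated on the interior bonds `(n·y + j, n·y + j + e_μ)`, `j_μ + 1 < n`, holds on every bond with both ends in one block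
(at least two blocks per direction). [folklore] -/
theorem le_of_bpt_of_blockOf_eq [NeZero n] (hM1 : ∀ μ, 1 < M μ) {F : Tor (fine n M) → Fin d → ℝ} {w : ℝ}
    (hF : ∀ (y : Tor M) (j : Fin d → Fin n) (μ : Fin d), (j μ : ℕ) + 1 < n → F (bpt n M y j) μ ≤ w) :
    ∀ (x : Tor (fine n M)) (μ : Fin d), blockOf n M (x + unitVec (fine n M) μ) = blockOf n M x → F x μ ≤ w := by
  intro x μ h
  -- every fine site is `n·(its block) + (its digits)` (surjectivity of `bpt`; cf. the tree's `RegionGaugeFixedVectorFlat.bpt_blockOf_digits`)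
  obtain ⟨⟨y, j⟩, rfl⟩ := (bpt_bijective n M).2 x
  exact hF y j μ (digits_succ_lt_of_blockOf_eq n M hM1 h)

/-! ## §2 V-REG closed at Bałaban's taxi data (Feynman–Landau form, `E = ℂ`) -/

/-- **LEAF V-REG CLOSED AT BAŁABAN's TAXI DATA, FEYNMAN–LANDAU FORM** (model level, `E = ℂ`).  DATA: unitary bond operators `R` on the level-`n` torus with operator
plaquette defect `≤ a`; carriers `QvL (lineT (taxiTv R) R)` (taxi frames + product line transports); `1 ≤ d`; at least two blocks per direction.  SMALLNESS
(k-UNIFORM under the plaquette class `n²·a ≤ c`): `2d·(n·(d−1)(n−1)a)² ≤ ½`, `40·d·(n²a) ≤ 1`, `κ⁻¹·3(d−1)n(n−1)a < 1`.  CONCLUSION: for every datum `φ` and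
every minimiser `W` of `ScV n M R (landauG 1 R)` on the fibre `{QvL (lineT (taxiTv R) R) · = φ}`,

  `rhoV n M R W ≤ (4Λ + ½)·(ScV n M R (landauG 1 R) W + nsqV M φ)`,  `Λ = lamV d (n·(d−1)(n−1)a) (d/1) (n²·0) ∕ (1 − κ⁻¹·3(d−1)n(n−1)a)²`

— NO leaf binder displayed: V-UB = leaf-04-g4's `exists_ubV_taxi_ScV` with (GF1′) for `landauG 1` from `landauG_le`; (Går) ∕ V-P ∕ V-REG = file 3/4's
`hREG_rhoV_landau_line` with the in-block defect `(d−1)(n−1)·a` of `(R, taxiTv R)` (`inBlock_defect_taxiTv_adjoint_le`, base-point ⟹ block form by §1). [folklore] -/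
theorem hREG_rhoV_landau_taxi {R : Tor (fine n M) → Fin d → (ℂ →L[ℂ] ℂ)} (hU : ∀ x μ, R x μ ∈ unitary (ℂ →L[ℂ] ℂ)) {a : ℝ} (ha0 : 0 ≤ a)
    (ha : ∀ x κ ι, ‖R x κ * R (x + unitVec (fine n M) κ) ι - R x ι * R (x + unitVec (fine n M) ι) κ‖ ≤ a) (hd : 1 ≤ d) (hM1 : ∀ μ, 1 < M μ)
    (hsmallw : 2 * (d : ℝ) * ((n : ℝ) * (((d - 1 : ℕ) : ℝ) * ((n - 1 : ℕ) : ℝ) * a)) ^ 2 ≤ 1 / 2)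
    (hsmallp : 40 * (d * ((n : ℝ) ^ 2 * a)) ≤ 1)
    (hc : (kappaV d n)⁻¹ * (3 * (((d - 1 : ℕ) : ℝ) * n * ((n - 1 : ℕ) : ℝ) * a)) < 1) :
    ∀ (φ : Tor M → Fin d → ℂ) (W : Tor (fine n M) → Fin d → ℂ), QvL n M (lineT n M (taxiTv n M R) R) W = φ →
      (∀ W₂, QvL n M (lineT n M (taxiTv n M R) R) W₂ = φ →
        ScV n M R (landauG (fine n M) 1 R) W ≤ ScV n M R (landauG (fine n M) 1 R) W₂) →
      rhoV n M R W ≤ (4 * (lamV d ((n : ℝ) * (((d - 1 : ℕ) : ℝ) * ((n - 1 : ℕ) : ℝ) * a)) ((d : ℝ) / 1) ((n : ℝ) ^ 2 * 0)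
          / (1 - (kappaV d n)⁻¹ * (3 * (((d - 1 : ℕ) : ℝ) * n * ((n - 1 : ℕ) : ℝ) * a))) ^ 2) + 1 / 2)
        * (ScV n M R (landauG (fine n M) 1 R) W + nsqV M φ) := by
  have hd0 : (0 : ℝ) ≤ d := Nat.cast_nonneg d
  -- the in-block defect of `(R, taxiTv R)` in block form
  have hw : ∀ (x : Tor (fine n M)) (μ : Fin d), blockOf n M (x + unitVec (fine n M) μ) = blockOf n M x →
      ‖R x μ * star (taxiTv n M R (x + unitVec (fine n M) μ)) * taxiTv n M R x - 1‖ ≤ ((d - 1 : ℕ) : ℝ) * ((n - 1 : ℕ) : ℝ) * a :=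
    le_of_bpt_of_blockOf_eq n M hM1 (F := fun x μ => ‖R x μ * star (taxiTv n M R (x + unitVec (fine n M) μ)) * taxiTv n M R x - 1‖)
      (fun y j μ h => inBlock_defect_taxiTv_adjoint_le n M hU ha y j μ h)
  -- leaf V-UB at taxi data (leaf-04-g4), for the Landau form via (GF1′) `landauG 1 R ≤ (d/1)·roughV + 0·nsqV`
  have hCG : (0 : ℝ) ≤ (d : ℝ) / 1 := by positivity
  have hUBc := exists_ubV_taxi_ScV n M hU ha0 ha hd hc (G := landauG (fine n M) 1 R) hCG le_rfl (fun W => landauG_le n M hU one_pos W)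
  have hΛ : 0 ≤ lamV d ((n : ℝ) * (((d - 1 : ℕ) : ℝ) * ((n - 1 : ℕ) : ℝ) * a)) ((d : ℝ) / 1) ((n : ℝ) ^ 2 * 0)
      / (1 - (kappaV d n)⁻¹ * (3 * (((d - 1 : ℕ) : ℝ) * n * ((n - 1 : ℕ) : ℝ) * a))) ^ 2 :=
    div_nonneg (lamV_nonneg hCG (by positivity)) (sq_nonneg _)
  exact hREG_rhoV_landau_line n M hU (taxiTv_mem_unitary n M hU) hw hsmallw ha0 ha hsmallp hΛ hUBc

end Summit.QuantumFields.BalabanUV.T4Continuum.VariationalVectorRegularityTaxi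

end
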